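import Literature.NumberTheory.Transcendental.KZCubicalCalculus
import Literature.NumberTheory.Transcendental.SemialgebraicLineDeriv
import Literature.NumberTheory.Transcendental.KZSemialgebraicComplex
import Literature.NumberTheory.Transcendental.KZIntervalPeriodProofs
import Summits.KontsevichZagierPeriods.KontsevichZagierPeriods.Theorems.InverseLandauFiveTermCertificateKit

/-!
# `FiveTermCertificate` (route InverseLandau): closure lemmas and positivity of the Landau letters

Support file for item `stmt-KontsevichZagierPeriods-13875`. Two kinds of bookkeeping for the
certificate of `InverseLandauFiveTermCertificateKit.lean` (names as in its glossary):

* closure of `AnalyticAt ℝ` and of `IsSemialgebraicFunOn ℚ` under `+, −, ·, /, ^` in the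
  syntactic lambda form over `Fin n → ℝ` (so that the integrands can be decomposed by `apply` at
  reducible transparency), after Mathlib and Bochnak–Coste–Roy, Prop. 2.2.6 as discharged in the
  tree (`IsSemialgebraicFunOn.fun_mul`, `fun_inv`, …);
* `facts`: every denominator occurring in the certificate — the Landau letters `1 − xw`,
  `1 − y − xwt`, `1 − xw − yt`, `(1−xw)(1−y) − xwyt`, `1 − yt`, … in the literal shapes in which they
  occur — is positive on the closed unit cube when `0 < x`, `0 < y`, `x + y < 1` (each is bounded
  below by `1 − x − y`), and so are the two loop homotopies `Ψ₁ = 1 + u·xw·mOne`, `Ψ₂ = 1 + u·y·mTwo`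
  (`psi_one_pos`, `psi_two_pos`).

References: J. Bochnak, M. Coste, M.-F. Roy, *Real Algebraic Geometry* (1998), Prop. 2.2.6.
-/

noncomputable section

namespace Summit.KontsevichZagierPeriods.InverseLandau.FiveTerm

open Set
open Literature.NumberTheory.Transcendental
open Literature.ModelTheory.ExponentialFields (IsSemialgebraic)

/-! ## Closure lemmas in syntactic (lambda, real-valued) form -/

section Closure

variable {n : ℕ} {f g : (Fin n → ℝ) → ℝ} {z : Fin n → ℝ} {W : Set (Fin n → ℝ)}

/-- Sum of functions analytic at a point. [folklore] -/
theorem an_add (hf : AnalyticAt ℝ f z) (hg : AnalyticAt ℝ g z) :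
    AnalyticAt ℝ (fun c => f c + g c) z := hf.add hg

/-- Difference of functions analytic at a point. [folklore] -/
theorem an_sub (hf : AnalyticAt ℝ f z) (hg : AnalyticAt ℝ g z) :
    AnalyticAt ℝ (fun c => f c - g c) z := hf.sub hg

/-- Product of functions analytic at a point. [folklore] -/
theorem an_mul (hf : AnalyticAt ℝ f z) (hg : AnalyticAt ℝ g z) :
    AnalyticAt ℝ (fun c => f c * g c) z := hf.mul hg

/-- Quotient of functions analytic at a point, denominator non-zero there. [folklore] -/
theorem an_div (hf : AnalyticAt ℝ f z) (hg : AnalyticAt ℝ g z) (h : g z ≠ 0) :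
    AnalyticAt ℝ (fun c => f c / g c) z := hf.div hg h

/-- Negative of a function analytic at a point. [folklore] -/
theorem an_neg (hf : AnalyticAt ℝ f z) : AnalyticAt ℝ (fun c => -f c) z := hf.neg

/-- Power of a function analytic at a point. [folklore] -/
theorem an_pow (hf : AnalyticAt ℝ f z) (k : ℕ) : AnalyticAt ℝ (fun c => f c ^ k) z := hf.pow k

/-- Constants are analytic. [folklore] -/
theorem an_const (a : ℝ) : AnalyticAt ℝ (fun _ : Fin n → ℝ => a) z := analyticAt_const

/-- Coordinate functions are analytic. [folklore] -/
theorem an_coord (i : Fin n) (z : Fin n → ℝ) : AnalyticAt ℝ (fun c : Fin n → ℝ => c i) z :=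
  (ContinuousLinearMap.proj (R := ℝ) (φ := fun _ : Fin n => ℝ) i).analyticAt z

/-- A product of non-zero reals is non-zero. [folklore] -/
theorem mul_ne_zero_real {a b : ℝ} (ha : a ≠ 0) (hb : b ≠ 0) : a * b ≠ 0 := mul_ne_zero ha hb

/-- A power of a non-zero real is non-zero. [folklore] -/
theorem pow_ne_zero_real {a : ℝ} (k : ℕ) (ha : a ≠ 0) : a ^ k ≠ 0 := pow_ne_zero k ha

/-- Quotients of real `ℚ`-semialgebraic functions are semialgebraic (Mathlib's `x / 0 = 0`
included). [Bochnak–Coste–Roy 1998, Prop. 2.2.6] -/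
theorem sa_div (hf : IsSemialgebraicFunOn ℚ W f) (hg : IsSemialgebraicFunOn ℚ W g) :
    IsSemialgebraicFunOn ℚ W fun c => f c / g c :=
  (hf.fun_mul hg.fun_inv).congr fun c _ => by simp [div_eq_mul_inv]

/-- The constant function `1` is `ℚ`-semialgebraic. [Bochnak–Coste–Roy 1998, §2.2] -/
theorem sa_one (hW : IsSemialgebraic ℚ W) : IsSemialgebraicFunOn ℚ W fun _ => (1 : ℝ) := by
  simpa using isSemialgebraicFunOn_const_natCast hW 1

end Closure

/-! ## Positivity of the Landau letters on the closed cube -/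

/-- `0 < d − c p` for `0 ≤ c < d` and `p ∈ [0,1]`. [folklore] -/
theorem sub_mul_pos {c d p : ℝ} (hc : 0 ≤ c) (hcd : c < d) (hp : p ∈ Icc (0 : ℝ) 1) :
    0 < d - c * p := by
  have : c * p ≤ c := mul_le_of_le_one_right hc hp.2
  linarith

/-- Coordinates of points of the closed cube lie in `[0,1]`. [folklore] -/
theorem mem_Icc_of_mem_cube {n : ℕ} {z : Fin n → ℝ} (hz : z ∈ KZ.cube n) (i : Fin n) :
    z i ∈ Icc (0 : ℝ) 1 :=
  ⟨(KZ.mem_cube.1 hz i).1, (KZ.mem_cube.1 hz i).2⟩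

/-- **All denominators of the certificate are positive on the closed cube** (in the literal
syntactic shapes in which they occur, for the coordinates `p, q, r ∈ [0,1]`): each is a Landau
letter bounded below by `1 − x − y > 0`. [folklore] -/
theorem facts {x y : ℝ} (hx : 0 < x) (hy : 0 < y) (hxy : x + y < 1) {p q r : ℝ}
    (hp : p ∈ Icc (0 : ℝ) 1) (hq : q ∈ Icc (0 : ℝ) 1) (hr : r ∈ Icc (0 : ℝ) 1) :
    0 < 1 - x ∧ 0 < 1 - y ∧ 0 < 1 - x * r ∧ 0 < (1 - y) - x * r * p ∧
    0 < (1 - x * r) - y * p ∧ 0 < 1 - x * r * p ∧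
    0 < (1 - x * r) * (1 - y) - x * r * y * p ∧ 0 < 1 - y * p ∧ 0 < 1 - y * q ∧
    0 < (1 - y) - (x * p * q) * r ∧ 0 < (1 - y * p * q) - x * r ∧ 0 < 1 - (x * p * q) * r ∧
    0 < 1 - y * p * q ∧ 0 < (1 - y) - (x * (1 - y) + x * y * p * q) * r ∧ 0 < 1 - (x * p) * r ∧
    0 < (1 - y) - (x * r * p) * q ∧ 0 < (1 - x * r) - (y * p) * q ∧ 0 < 1 - (x * r * p) * q ∧
    0 < (1 - x * r) * (1 - y) - (x * r * y * p) * q ∧ 0 < 1 - (x * r) * p ∧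
    0 < (1 - y) - x * p * q ∧ 0 < (1 - x) - y * p * q ∧ 0 < 1 - x * p * q ∧
    0 < (1 - x) * (1 - y) - x * y * p * q ∧ 0 < 1 - x * p := by
  have hx1 : x < 1 := by linarith
  have hy1 : y < 1 := by linarith
  have hxr : x * r ≤ x := mul_le_of_le_one_right hx.le hr.2
  have hxr0 : 0 ≤ x * r := mul_nonneg hx.le hr.1
  have hxp : x * p ≤ x := mul_le_of_le_one_right hx.le hp.2
  have hxp0 : 0 ≤ x * p := mul_nonneg hx.le hp.1
  have hyp : y * p ≤ y := mul_le_of_le_one_right hy.le hp.2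
  have hyp0 : 0 ≤ y * p := mul_nonneg hy.le hp.1
  have hxpq : x * p * q ≤ x := (mul_le_of_le_one_right hxp0 hq.2).trans hxp
  have hxpq0 : 0 ≤ x * p * q := mul_nonneg hxp0 hq.1
  have hypq : y * p * q ≤ y := (mul_le_of_le_one_right hyp0 hq.2).trans hyp
  have hxrp : x * r * p ≤ x := (mul_le_of_le_one_right hxr0 hp.2).trans hxr
  have hxrp0 : 0 ≤ x * r * p := mul_nonneg hxr0 hp.1
  have hxy0 : 0 ≤ x * y := mul_nonneg hx.le hy.le
  have hxry : x * r * y ≤ x * y := mul_le_mul_of_nonneg_right hxr hy.le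
  have hxry0 : 0 ≤ x * r * y := mul_nonneg hxr0 hy.le
  have hxryp : x * r * y * p ≤ x * y := (mul_le_of_le_one_right hxry0 hp.2).trans hxry
  have hxryp0 : 0 ≤ x * r * y * p := mul_nonneg hxry0 hp.1
  have hxyp : x * y * p ≤ x * y := mul_le_of_le_one_right hxy0 hp.2
  have hxyp0 : 0 ≤ x * y * p := mul_nonneg hxy0 hp.1
  have hxypq : x * y * p * q ≤ x * y := (mul_le_of_le_one_right hxyp0 hq.2).trans hxyp
  have key : (1 - x) * (1 - y) = (1 - x - y) + x * y := by ring
  have hD : x * y < (1 - x * r) * (1 - y) := by nlinarith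
  refine ⟨by linarith, by linarith, sub_mul_pos hx.le hx1 hr, sub_mul_pos hxr0 (by linarith) hp,
    sub_mul_pos hy.le (by linarith) hp, sub_mul_pos hxr0 (by linarith) hp,
    sub_mul_pos hxry0 (lt_of_le_of_lt hxry hD) hp, sub_mul_pos hy.le hy1 hp, sub_mul_pos hy.le hy1 hq,
    sub_mul_pos hxpq0 (by linarith) hr, ?_, sub_mul_pos hxpq0 (by linarith) hr,
    sub_mul_pos hyp0 (by linarith) hq, ?_, sub_mul_pos hxp0 (by linarith) hr,
    sub_mul_pos hxrp0 (by linarith) hq, sub_mul_pos hyp0 (by linarith) hq,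
    sub_mul_pos hxrp0 (by linarith) hq, sub_mul_pos hxryp0 (lt_of_le_of_lt hxryp hD) hq,
    sub_mul_pos hxr0 (by linarith) hp, sub_mul_pos hxp0 (by linarith) hq,
    sub_mul_pos hyp0 (by linarith) hq, sub_mul_pos hxp0 (by linarith) hq,
    sub_mul_pos hxyp0 (by nlinarith) hq, sub_mul_pos hx.le hx1 hp⟩
  · have : x * r ≤ x := hxr
    nlinarith
  · have h1 : x * (1 - y) + x * y * p * q ≤ x := by nlinarith
    have h0 : 0 ≤ x * (1 - y) + x * y * p * q := by nlinarith
    exact sub_mul_pos h0 (by linarith) hr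

/-- The first loop homotopy `Ψ₁ = 1 + u · xw · mOne` is positive on the closed cube
(`mOne ≤ 0`, so `Ψ₁ ≥ φ₁ = (1 − xwt)·((1−xw)(1−y) − xwyt)/((1−xw)(1−y−xwt)) > 0`). [folklore] -/
theorem psi_one_pos {x y : ℝ} (hx : 0 < x) (hy : 0 < y) (hxy : x + y < 1) {t u w : ℝ}
    (ht : t ∈ Icc (0 : ℝ) 1) (hu : u ∈ Icc (0 : ℝ) 1) (hw : w ∈ Icc (0 : ℝ) 1) :
    0 < 1 + u * (x * w) * ((x * w * y) * (t * (t - 1)) / ((1 - x * w) * ((1 - y) - x * w * t))) := by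
  obtain ⟨-, -, f3, f4, -, f6, f7, -⟩ := facts hx hy hxy ht ht hw
  have hm : ((x * w * y) * (t * (t - 1)) / ((1 - x * w) * ((1 - y) - x * w * t))) ≤ 0 := by
    apply div_nonpos_of_nonpos_of_nonneg
    · have : t * (t - 1) ≤ 0 := by nlinarith [ht.1, ht.2]
      exact mul_nonpos_of_nonneg_of_nonpos (mul_nonneg (mul_nonneg hx.le hw.1) hy.le) this
    · exact (mul_pos f3 f4).le
  have hφ : 0 < 1 + x * w * ((x * w * y) * (t * (t - 1)) / ((1 - x * w) * ((1 - y) - x * w * t))) := by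
    rw [one_add_mul_mOne x y t w f3.ne' f4.ne']
    exact div_pos (mul_pos f6 f7) (mul_pos f3 f4)
  have hxw : 0 ≤ x * w := mul_nonneg hx.le hw.1
  have : x * w * ((x * w * y) * (t * (t - 1)) / ((1 - x * w) * ((1 - y) - x * w * t))) ≤ u * (x * w) * ((x * w * y) * (t * (t - 1)) / ((1 - x * w) * ((1 - y) - x * w * t))) := by
    have h1 : u * (x * w * ((x * w * y) * (t * (t - 1)) / ((1 - x * w) * ((1 - y) - x * w * t)))) ≥ 1 * (x * w * ((x * w * y) * (t * (t - 1)) / ((1 - x * w) * ((1 - y) - x * w * t)))) :=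
      mul_le_mul_of_nonpos_right hu.2 (mul_nonpos_of_nonneg_of_nonpos hxw hm)
    nlinarith
  linarith

/-- The second loop homotopy `Ψ₂ = 1 + u · y · mTwo` is positive on the closed cube. [folklore] -/
theorem psi_two_pos {x y : ℝ} (hx : 0 < x) (hy : 0 < y) (hxy : x + y < 1) {t u w : ℝ}
    (ht : t ∈ Icc (0 : ℝ) 1) (hu : u ∈ Icc (0 : ℝ) 1) (hw : w ∈ Icc (0 : ℝ) 1) :
    0 < 1 + u * y * ((x * w * y) * (t * (t - 1)) / ((1 - y) * ((1 - x * w) - y * t))) := by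
  obtain ⟨-, f2, f3, -, f5, -, f7, f8, -⟩ := facts hx hy hxy ht ht hw
  have hm : ((x * w * y) * (t * (t - 1)) / ((1 - y) * ((1 - x * w) - y * t))) ≤ 0 := by
    apply div_nonpos_of_nonpos_of_nonneg
    · have : t * (t - 1) ≤ 0 := by nlinarith [ht.1, ht.2]
      exact mul_nonpos_of_nonneg_of_nonpos (mul_nonneg (mul_nonneg hx.le hw.1) hy.le) this
    · exact (mul_pos f2 f5).le
  have hφ : 0 < 1 + y * ((x * w * y) * (t * (t - 1)) / ((1 - y) * ((1 - x * w) - y * t))) := by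
    rw [one_add_mul_mTwo x y t w f2.ne' f5.ne']
    exact div_pos (mul_pos f8 f7) (mul_pos f2 f5)
  have : y * ((x * w * y) * (t * (t - 1)) / ((1 - y) * ((1 - x * w) - y * t))) ≤ u * y * ((x * w * y) * (t * (t - 1)) / ((1 - y) * ((1 - x * w) - y * t))) := by
    have h1 : u * (y * ((x * w * y) * (t * (t - 1)) / ((1 - y) * ((1 - x * w) - y * t)))) ≥ 1 * (y * ((x * w * y) * (t * (t - 1)) / ((1 - y) * ((1 - x * w) - y * t)))) :=
      mul_le_mul_of_nonpos_right hu.2 (mul_nonpos_of_nonneg_of_nonpos hy.le hm)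
    nlinarith
  linarith

end Summit.KontsevichZagierPeriods.InverseLandau.FiveTerm
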